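import Summits.BirchSwinnertonDyer.Rank1Residual.GaloisImage.LocalThreeTorsionCountAt
import Summits.BirchSwinnertonDyer.Rank1Residual.GaloisImage.NineDivisionFrobeniusPoint
import Summits.BirchSwinnertonDyer.Rank1Residual.GaloisImage.PadicRootCensus
import Summits.BirchSwinnertonDyer.Rank1Residual.Additive.CuspDivisionPolynomialFiveSeven
import HarnessLib

/-!
# `n`-torsion of `E(ℚ_ℓ)` for an odd prime `n` at EVERY prime `ℓ`: `nP = O ⟺ ψₙ(x) = 0`, the abscissae
# are `ℓ`-adic integers, and `ψ₅`, `ψ₇` as EXACT integer coefficient lists (cell `b2b-bsdres`,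
# supersingular family, prover A = unit `b2b-bsdres-x10b`, gen 23 — TOOL for the local binder
# `#F(ℚ_w)[p] = 1` of the rank-0 VISIBILITY offers at `p = 5, 7`; the odd-prime twin of n1011's
# `LocalThreeTorsionCountAt` / `LocalThreeTorsionCount`)

HONEST FRAMING (cell `b2b-bsdres`, run/shared/lean/b2b/bsd-rank1-residual/, verbatim in every
file): the goal of the cell is to DELETE the COMBINATION-SHAPED residual classes of the
Birch–Swinnerton-Dyer formula for ALL analytic-rank `≤ 1` elliptic curves over `ℚ` — "full BSD
formula for every rank `≤ 1` curve in class `C`" assembled STRICTLY from published theorems — so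
that the rank-`≤ 1` remainder becomes exactly the CONSTRUCTION-SHAPED classes, which are TYPED
(missing-input `Prop`s), NOT attempted. This is not "finishing BSD". This file is a TOOL (local
arithmetic of `E(ℚ_ℓ)` and computable bookkeeping lists); nothing is booked by it; no mark / label /
count moved; X6 / X7 stay CONSTRUCTION-SHAPED. THEOREMS + two computable list definitions
(`prePsi5Z`, `prePsi7Z`, no mathematical content); no named fact, no `sorry`.

## What

* §1 — n1011's computable integer list arithmetic `Frob9.addL / negL / subL / smulL / mulL`
  (`GaloisImage/NineDivisionFrobeniusListPoly.lean`, there read in `(ZMod ℓ)[X]`) read in `ℤ[X]`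
  through `RootCensus.ofList` (`GaloisImage/PadicRootCensus.lean`, the input format of the Hensel
  root census `RootCensus.check₂`): `ofList_addL`, `ofList_negL`, `ofList_subL`, `ofList_smulL`,
  `ofList_mulL`.
* §2 — EXACT (unreduced) integer coefficient lists of Mathlib's univariate division polynomials of an
  integer equation `E₀`: n1011's `Frob9.psi2sqL / psi3L / prePsi4L` are `Ψ₂Sq`, `Ψ₃`, `preΨ₄` in
  `ℤ[X]` (`ofList_psi2sqL`, `ofList_psi3L`, `ofList_prePsi4L`), and the NEW lists
  `prePsi5Z E₀ := prePsi4L·psi2sqL² − psi3L³`, `prePsi7Z E₀ := prePsi5Z·psi3L³ − prePsi4L³·psi2sqL²`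
  are `preΨ' 5`, `preΨ' 7` (`ofList_prePsi5Z`, `ofList_prePsi7Z`; Mathlib's `preΨ'_odd` at
  `m = 0, 1`, tree `CuspTorsion.preΨ'_five / preΨ'_seven`); `aeval_ofList_eq_eval_preΨ'` moves them
  to any commutative ring (`WeierstrassCurve.map_preΨ'`).
* §3 — over `ℚ_ℓ`, for a Weierstrass equation `E` with `ℓ`-integral coefficients and `Δ ≠ 0`:
  `nsmul_some_eq_zero_iff_eval_preΨ'` — for ODD `n`, an affine point `P = (x, y)` has `nP = O` iff
  `preΨ'ₙ(x) = 0` (tree `Affine.Point.zsmul_some_eq_zero_iff`, Silverman *AEC* Ex. 3.7(f), PROVED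
  in `Literature/…/DivisionPolynomialMultiplication`; on the curve `ψₙ(x, y) = preΨ'ₙ(x)` for odd
  `n`, tree `Frob9.evalEval_ψ_eq_eval_preΨ'_of_equation`); `norm_le_one_of_nsmul_eq_zero` — for
  `ℓ ∤ n` such a point has `‖x‖_ℓ ≤ 1` (AEC VII.3.1: `Ê(ℓℤ_ℓ)` has no prime-to-`ℓ` torsion, tree
  `WeierstrassCurve.norm_formalParameter_nsmul_of_not_dvd`, exactly as n1011's `ℓ ≠ 3` lemma
  `LocalTorsion3At.norm_le_one_of_three_nsmul_eq_zero`); `norm_le_one_of_prime_nsmul_eq_zero` — for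
  an ODD PRIME `n` the same at EVERY `ℓ`, the case `ℓ = n` by AEC IV.6.1 (`‖z(ℓP)‖ = ℓ⁻¹‖z(P)‖` on
  `E₁(ℚ_ℓ)` for odd `ℓ`, tree `WeierstrassCurve.norm_formalParameter_p_nsmul_eq`);
  `norm_le_one_of_equation_of_eval_preΨ'` — the `preΨ'ₙ`-phrased corollary used by the decider.

Consumer: `Supersingular/LocalOddTorsionDeciderAt.lean` (`#E(ℚ_ℓ)[n] = 1 + 2·#{roots of preΨ'ₙ in ℤ_ℓ
with g a non-zero square}` for `n = 5, 7`, every prime `ℓ`), whose consumer shapes are LITERALLY the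
local binders `Nat.card (nsmulAddMonoidHom p : (F.baseChange (w.adicCompletion ℚ)).toAffine.Point →+
_).ker = 1` of `Supersingular/X6Visibility*`, `X7Visibility*` (x10b gen 15–16; free kind (i) at
`w ≠ p`, the paid place `w = p`).
References: [SilvermanAEC2009] Ex. 3.7 (d)(f), IV.3.2(b), IV.6.1, VII.3.1; Mathlib
`WeierstrassCurve.preΨ'_odd`, `map_preΨ'`.
-/

set_option autoImplicit false

noncomputable section

open scoped Classical
open Polynomial WeierstrassCurve
open Summit.BirchSwinnertonDyer.Rank1Residual.GaloisImage.RootCensus (ofList aeval_ofList_cons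
  aeval_ofList_nil coe_aeval_ofList)
open Summit.BirchSwinnertonDyer.Rank1Residual.GaloisImage.Frob9 (addL negL subL smulL mulL psi2sqL
  psi3L prePsi4L evalEval_ψ_eq_eval_preΨ'_of_equation)

namespace Summit.BirchSwinnertonDyer.Rank1Residual.Supersingular.LocalOddTorsion

/-! ### §1 Integer list arithmetic read in `ℤ[X]` -/

section ListPoly

/-- `ofList [] = 0`. [folklore] -/
@[simp] theorem ofList_nil : ofList [] = 0 := rfl

/-- `ofList (a :: l) = C a + X · ofList l` (Horner step). [folklore] -/
@[simp] theorem ofList_cons (a : ℤ) (l : List ℤ) : ofList (a :: l) = C a + X * ofList l := rfl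

/-- `ofList` is additive on n1011's `addL`. [folklore] -/
theorem ofList_addL : ∀ l m : List ℤ, ofList (addL l m) = ofList l + ofList m
  | [], m => by simp [addL]
  | a :: l, [] => by simp [addL]
  | a :: l, b :: m => by
    rw [addL, ofList_cons, ofList_cons, ofList_cons, ofList_addL l m, C_add]
    ring

/-- `ofList` commutes with negation (`negL`). [folklore] -/
theorem ofList_negL : ∀ l : List ℤ, ofList (negL l) = -ofList l
  | [] => by simp [negL]
  | a :: l => by
    have h := ofList_negL l
    simp only [negL, List.map_cons] at h ⊢
    rw [ofList_cons, ofList_cons]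
    change C (-a) + X * ofList (negL l) = _
    rw [ofList_negL l, C_neg]
    ring

/-- `ofList` commutes with subtraction (`subL`). [folklore] -/
theorem ofList_subL (l m : List ℤ) : ofList (subL l m) = ofList l - ofList m := by
  rw [subL, ofList_addL, ofList_negL, sub_eq_add_neg]

/-- `ofList` commutes with scalar multiplication (`smulL`). [folklore] -/
theorem ofList_smulL (c : ℤ) : ∀ l : List ℤ, ofList (smulL c l) = C c * ofList l
  | [] => by simp [smulL]
  | a :: l => by
    have h := ofList_smulL c l
    simp only [smulL, List.map_cons] at h ⊢
    rw [ofList_cons, ofList_cons]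
    change C (c * a) + X * ofList (smulL c l) = _
    rw [ofList_smulL c l, C_mul]
    ring

/-- `ofList` is multiplicative on n1011's schoolbook product `mulL`. [folklore] -/
theorem ofList_mulL : ∀ l m : List ℤ, ofList (mulL l m) = ofList l * ofList m
  | [], m => by simp [mulL]
  | a :: l, m => by
    rw [mulL, ofList_addL, ofList_smulL, ofList_cons, ofList_cons, ofList_mulL l m, C_0, zero_add]
    ring

end ListPoly

/-! ### §2 `Ψ₂Sq`, `Ψ₃`, `preΨ₄`, `preΨ₅`, `preΨ₇` of an integer equation as exact integer lists -/

section DivisionPolynomialLists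

variable (E₀ : WeierstrassCurve ℤ)

/-- **`preΨ₅` as an exact integer coefficient list**: `prePsi4L·psi2sqL² − psi3L³` (ascending, degree
`12`, leading coefficient `5`). Computable bookkeeping; its meaning is `ofList_prePsi5Z`. [folklore] -/
def prePsi5Z : List ℤ :=
  subL (mulL (prePsi4L E₀) (mulL (psi2sqL E₀) (psi2sqL E₀)))
    (mulL (psi3L E₀) (mulL (psi3L E₀) (psi3L E₀)))

/-- **`preΨ₇` as an exact integer coefficient list**: `prePsi5Z·psi3L³ − prePsi4L³·psi2sqL²`
(ascending, degree `24`, leading coefficient `7`). Computable bookkeeping; meaning `ofList_prePsi7Z`.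
[folklore] -/
def prePsi7Z : List ℤ :=
  subL (mulL (prePsi5Z E₀) (mulL (psi3L E₀) (mulL (psi3L E₀) (psi3L E₀))))
    (mulL (mulL (prePsi4L E₀) (mulL (prePsi4L E₀) (prePsi4L E₀))) (mulL (psi2sqL E₀) (psi2sqL E₀)))

variable {E₀}

/-- `ofList psi2sqL = Ψ₂Sq = 4X³ + b₂X² + 2b₄X + b₆` in `ℤ[X]`. [folklore] -/
theorem ofList_psi2sqL : ofList (psi2sqL E₀) = E₀.Ψ₂Sq := by
  simp only [psi2sqL, ofList_cons, ofList_nil, WeierstrassCurve.Ψ₂Sq, C_mul, map_ofNat]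
  ring

/-- `ofList psi3L = Ψ₃ = 3X⁴ + b₂X³ + 3b₄X² + 3b₆X + b₈` in `ℤ[X]`. [folklore] -/
theorem ofList_psi3L : ofList (psi3L E₀) = E₀.Ψ₃ := by
  simp only [psi3L, ofList_cons, ofList_nil, WeierstrassCurve.Ψ₃, C_mul, map_ofNat]
  ring

/-- `ofList prePsi4L = preΨ₄` in `ℤ[X]`. [folklore] -/
theorem ofList_prePsi4L : ofList (prePsi4L E₀) = E₀.preΨ₄ := by
  simp only [prePsi4L, ofList_cons, ofList_nil, WeierstrassCurve.preΨ₄, C_mul, C_sub, C_pow,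
    map_ofNat]
  ring

/-- **`ofList prePsi5Z = preΨ' 5` in `ℤ[X]`** (Mathlib's `preΨ'_odd` at `m = 0`:
`preΨ₅ = preΨ₄·Ψ₂Sq² − Ψ₃³`, tree `CuspTorsion.preΨ'_five`). [cite: SilvermanAEC2009, Exercise 3.7 (d)] -/
theorem ofList_prePsi5Z : ofList (prePsi5Z E₀) = E₀.preΨ' 5 := by
  rw [Additive.CuspTorsion.preΨ'_five, prePsi5Z, ofList_subL, ofList_mulL, ofList_mulL, ofList_mulL,
    ofList_mulL, ofList_psi2sqL, ofList_psi3L, ofList_prePsi4L]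
  ring

/-- **`ofList prePsi7Z = preΨ' 7` in `ℤ[X]`** (Mathlib's `preΨ'_odd` at `m = 1`:
`preΨ₇ = preΨ₅·Ψ₃³ − preΨ₄³·Ψ₂Sq²`, tree `CuspTorsion.preΨ'_seven`). [cite: SilvermanAEC2009, Exercise 3.7 (d)] -/
theorem ofList_prePsi7Z : ofList (prePsi7Z E₀) = E₀.preΨ' 7 := by
  rw [Additive.CuspTorsion.preΨ'_seven, prePsi7Z, ofList_subL, ofList_mulL, ofList_mulL, ofList_mulL,
    ofList_mulL, ofList_mulL, ofList_mulL, ofList_mulL, ofList_prePsi5Z, ofList_psi2sqL, ofList_psi3L,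
    ofList_prePsi4L]
  ring

/-- Transport to any commutative ring `R`: if `ofList l = preΨ'ₙ(E₀)` in `ℤ[X]` then
`aeval x (ofList l) = preΨ'ₙ(E₀ ⊗ R)(x)` for every `x : R` (Mathlib `map_preΨ'`). [folklore] -/
theorem aeval_ofList_eq_eval_preΨ' {R : Type*} [CommRing R] {l : List ℤ} {n : ℕ}
    (hl : ofList l = E₀.preΨ' n) (x : R) :
    aeval x (ofList l) = ((E₀.map (algebraMap ℤ R)).preΨ' n).eval x := by
  rw [hl, WeierstrassCurve.map_preΨ', eval_map, aeval_def]

/-- Transport of `Ψ₂Sq`: `aeval x (ofList psi2sqL) = 4x³ + b₂x² + 2b₄x + b₆` of `E₀ ⊗ R`. [folklore] -/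
theorem aeval_ofList_psi2sqL {R : Type*} [CommRing R] (x : R) :
    aeval x (ofList (psi2sqL E₀)) = 4 * x ^ 3 + (E₀.map (algebraMap ℤ R)).b₂ * x ^ 2 +
      2 * (E₀.map (algebraMap ℤ R)).b₄ * x + (E₀.map (algebraMap ℤ R)).b₆ := by
  simp only [psi2sqL, aeval_ofList_cons, aeval_ofList_nil, WeierstrassCurve.map_b₂,
    WeierstrassCurve.map_b₄, WeierstrassCurve.map_b₆, eq_intCast]
  push_cast
  ring

end DivisionPolynomialLists

/-! ### §3 Over `ℚ_ℓ`: `nP = O ⟺ preΨ'ₙ(x) = 0` (odd `n`), and `x ∈ ℤ_ℓ` (`ℓ ∤ n`, or `n` an odd prime) -/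

section Padic

variable {p : ℕ} [hp : Fact p.Prime] (E : WeierstrassCurve ℚ_[p]) [hE : E.IsIntegral ℤ_[p]]

omit hE in
/-- **`nP = O ⟺ preΨ'ₙ(x(P)) = 0` for ODD `n`** and an affine point `P = (x, y)` of `E/ℚ_ℓ`
(Silverman AEC Ex. 3.7(f): the tree's PROVED `Affine.Point.zsmul_some_eq_zero_iff`, and on the curve
`ψₙ(x, y) = preΨ'ₙ(x)` for odd `n`, tree `Frob9.evalEval_ψ_eq_eval_preΨ'_of_equation`). Field-generic;
restated over `ℚ_ℓ` for the consumer. [cite: SilvermanAEC2009, Exercise 3.7(f)] -/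
theorem nsmul_some_eq_zero_iff_eval_preΨ' {n : ℕ} (hn : ¬ Even n) {x y : ℚ_[p]}
    (h : E.toAffine.Nonsingular x y) :
    n • (Affine.Point.some x y h : E.toAffine.Point) = 0 ↔ (E.preΨ' n).eval x = 0 := by
  have key := Affine.Point.zsmul_some_eq_zero_iff h (n : ℤ)
  rw [natCast_zsmul] at key
  rw [key, evalEval_ψ_eq_eval_preΨ'_of_equation E h.left n hn]

variable [E.IsElliptic]

/-- **A non-zero `n`-torsion point of `E(ℚ_ℓ)`, `ℓ ∤ n`, is not in the kernel of reduction**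
(`Ê(ℓℤ_ℓ)` has no prime-to-`ℓ` torsion: `‖z(nP)‖ = ‖z(P)‖`). [cite: SilvermanAEC2009, VII.3.1] -/
theorem not_isInReductionKernel_of_nsmul_eq_zero {n : ℕ} (hpn : ¬ p ∣ n) {P : E.toAffine.Point}
    (hP0 : P ≠ 0) (hnP : n • P = 0) : ¬ E.IsInReductionKernel P := by
  intro hPk
  have key := E.norm_formalParameter_nsmul_of_not_dvd hpn hPk
  rw [hnP, E.formalParameter_zero, norm_zero] at key
  exact hP0 ((E.formalParameter_eq_zero_iff hPk).mp (norm_eq_zero.mp key.symm))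

omit [E.IsElliptic] in
/-- **A non-zero `ℓ`-torsion point of `E(ℚ_ℓ)`, `ℓ` ODD, is not in the kernel of reduction**
(Silverman AEC IV.6.1 with `v(ℓ) = 1 < ℓ - 1`: `‖z(ℓP)‖ = ℓ⁻¹‖z(P)‖` on all of `E₁(ℚ_ℓ)`, the tree's
`WeierstrassCurve.norm_formalParameter_p_nsmul_eq`). [cite: SilvermanAEC2009, IV.6.1] -/
theorem not_isInReductionKernel_of_p_nsmul_eq_zero (hp2 : p ≠ 2) {P : E.toAffine.Point}
    (hP0 : P ≠ 0) (hpP : p • P = 0) : ¬ E.IsInReductionKernel P := by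
  intro hPk
  have key := E.norm_formalParameter_p_nsmul_eq hp2 hPk
  rw [hpP, E.formalParameter_zero, norm_zero] at key
  have hp0 : (0 : ℝ) < (p : ℝ)⁻¹ := inv_pos.mpr (by exact_mod_cast hp.out.pos)
  have hz : ‖E.formalParameter P‖ = 0 := by
    rcases mul_eq_zero.mp key.symm with h | h
    · exact absurd h hp0.ne'
    · exact h
  exact hP0 ((E.formalParameter_eq_zero_iff hPk).mp (norm_eq_zero.mp hz))

/-- **A non-zero `n`-torsion point of `E(ℚ_ℓ)`, `n` an ODD PRIME, is not in the kernel of reduction —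
at EVERY prime `ℓ`** (`ℓ ≠ n`: no prime-to-`ℓ` torsion in `Ê(ℓℤ_ℓ)`, AEC IV.3.2(b); `ℓ = n`: AEC IV.6.1,
`n` odd). [cite: SilvermanAEC2009, IV.6.1] -/
theorem not_isInReductionKernel_of_prime_nsmul_eq_zero {n : ℕ} (hn : n.Prime) (hn2 : n ≠ 2)
    {P : E.toAffine.Point} (hP0 : P ≠ 0) (hnP : n • P = 0) : ¬ E.IsInReductionKernel P := by
  by_cases hpn : p ∣ n
  · have hpn' : p = n := (Nat.prime_dvd_prime_iff_eq hp.out hn).mp hpn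
    subst hpn'
    exact not_isInReductionKernel_of_p_nsmul_eq_zero E hn2 hP0 hnP
  · exact not_isInReductionKernel_of_nsmul_eq_zero E hpn hP0 hnP

/-- **The `x`-coordinate of a `ℚ_ℓ`-rational `n`-torsion point of an `ℓ`-integral equation is an
`ℓ`-adic integer**, for every prime `ℓ ∤ n` (including `ℓ = 2`). [cite: SilvermanAEC2009, VII.3.1] -/
theorem norm_le_one_of_nsmul_eq_zero {n : ℕ} (hpn : ¬ p ∣ n) {x y : ℚ_[p]}
    (h : E.toAffine.Nonsingular x y)
    (hnP : n • (Affine.Point.some x y h : E.toAffine.Point) = 0) : ‖x‖ ≤ 1 := by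
  by_contra hx
  rw [not_le] at hx
  exact not_isInReductionKernel_of_nsmul_eq_zero E hpn (P := Affine.Point.some x y h)
    (by rintro ⟨⟩) hnP ((E.isInReductionKernel_some h).mpr hx)

/-- **The `x`-coordinate of a `ℚ_ℓ`-rational `n`-torsion point, `n` an odd prime, of an `ℓ`-integral
equation is an `ℓ`-adic integer — at EVERY prime `ℓ`** (also `ℓ = n` and `ℓ = 2`).
[cite: SilvermanAEC2009, IV.6.1] -/
theorem norm_le_one_of_prime_nsmul_eq_zero {n : ℕ} (hn : n.Prime) (hn2 : n ≠ 2) {x y : ℚ_[p]}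
    (h : E.toAffine.Nonsingular x y)
    (hnP : n • (Affine.Point.some x y h : E.toAffine.Point) = 0) : ‖x‖ ≤ 1 := by
  by_contra hx
  rw [not_le] at hx
  exact not_isInReductionKernel_of_prime_nsmul_eq_zero E hn hn2 (P := Affine.Point.some x y h)
    (by rintro ⟨⟩) hnP ((E.isInReductionKernel_some h).mpr hx)

/-- An odd prime is not even. [folklore] -/
theorem not_even_of_prime_ne_two {n : ℕ} (hn : n.Prime) (hn2 : n ≠ 2) : ¬ Even n :=
  fun h => hn2 (hn.even_iff.mp h)

/-- Corollary in `preΨ'ₙ`-language: for an odd prime `n` and ANY prime `ℓ`, a root `x ∈ ℚ_ℓ` of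
`preΨ'ₙ` carrying a point of `E(ℚ_ℓ)` is an `ℓ`-adic integer. [cite: SilvermanAEC2009, IV.6.1] -/
theorem norm_le_one_of_equation_of_eval_preΨ' {n : ℕ} (hn : n.Prime) (hn2 : n ≠ 2)
    {x y : ℚ_[p]} (heq : E.toAffine.Equation x y) (hΨ : (E.preΨ' n).eval x = 0) : ‖x‖ ≤ 1 := by
  have hns : E.toAffine.Nonsingular x y := (Affine.equation_iff_nonsingular).mp heq
  exact norm_le_one_of_prime_nsmul_eq_zero E hn hn2 hns
    ((nsmul_some_eq_zero_iff_eval_preΨ' E (not_even_of_prime_ne_two hn hn2) hns).mpr hΨ)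

end Padic

end Summit.BirchSwinnertonDyer.Rank1Residual.Supersingular.LocalOddTorsion

end
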